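import Literature.AlgebraicGeometry.HodgeTheory.AlgebraicityLocusBoundary
import Literature.AlgebraicGeometry.Motives.SegrePowers
import Literature.AlgebraicGeometry.Motives.ProjectiveClosedSetsForms
import HarnessLib

/-!
# Complete witnesses for the algebraicity locus: tuples of hypersurface sections of the fibres

Topic `Literature/AlgebraicGeometry/HodgeTheory` (family `hodge`), sixth proof file towards the
named fact `charlesSchnell_algebraicityLocus_iUnion_closed` (`AlgebraicityLocus.lean`). The
assembly `algebraicityLocus_eq_iUnion_of_dichotomy` (`AlgebraicityLocusAssembly`) takes a COMPLETE
countable family of proper parameter spaces of supports: every Zariski-closed subset of a fibre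
`𝒳_t` must be the support over some complex point over `t`. In print these are the components of
the relative Hilbert scheme; on the tree's carriers (no Hilbert schemes) this file constructs an
elementary complete family and PROVES its completeness:

* `SupportFamily` — the shape (parameter `ℂ`-scheme `T`, `h : T ⟶ S`, `𝒵 ⊆ 𝒳 × T`), with the
  graph family (`SupportFamily.graph`: `T = S`, `𝒵 = Γ_f`) and the step adding one incidence
  condition with projective parameters (`SupportFamily.step`); closedness and properness
  (`isClosedImmersion_lift_id`: the graph of `f` is a closed immersion for `S` separated,
  Stacks 01KS; `isClosed_step_𝒵`, `isProper_step_h`) and the point-level dictionary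
  (`pt_lift_mem_step_𝒵_iff`, `apply_eq_pt_of_sliceAt_mem_graph_𝒵`, …).
* `hyperplaneFamily f ε d m` — for `ε : 𝒳 ⟶ ℙᴺ`, the family with parameters
  `((ℙ^{N_d})^*)^m × S` whose support over `(a₁, …, a_m, t)` is
  `𝒳_t ∩ (ε ≫ s_d)⁻¹(H_{a₁}) ∩ ⋯ ∩ (ε ≫ s_d)⁻¹(H_{a_m})`, `s_d` the Segre–diagonal map of
  `Motives/SegrePowers` (so these are the tuples of hypersurface sections of degree `d + 1`);
  proper over `S` (`isProper_hyperplaneFamily_h`), closed (`isClosed_hyperplaneFamily_𝒵`), and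
  a point `x` with `(x, y)` in the support lies over `h(y)`
  (`apply_eq_pt_of_sliceAt_mem_hyperplaneFamily_𝒵`).
* `exists_tuplePoint_forall_mem_iff` — **COMPLETENESS**: for `f` proper, `S` separated and
  locally of finite type over `ℂ`, and `ε` a topological embedding, every Zariski-closed `Z ⊆ 𝒳_t`
  is the support over the complex point `tuplePoint t a` for suitable `d`, `m` and hyperplanes
  `a`: `ι_t(Z) = ε⁻¹(W)`, `W = ⋂ V₊(gᵢ)` with forms of one degree
  (`Motives.exists_forms_eq_iInter_zeroLocus_of_isClosed`), `gᵢ ↦` hyperplanes of `ℙ^{N_d}`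
  (`Motives.ProjectiveSpace.segreCoeff`), and two closed subsets of the Jacobson scheme `𝒳_t`
  with the same complex points coincide (`eq_of_isClosed_of_forall_pt_mem_iff`).

## References

* [CharlesSchnell2014Notes] F. Charles, C. Schnell, Notes on absolute Hodge classes, in Hodge
  Theory (Princeton Math. Notes 49, 2014), Prop. 11.3.11 (proof: "every pair (X_s, Z) is
  parametrised by one of the relative Hilbert schemes").
* [Hartshorne1977] R. Hartshorne, Algebraic Geometry (1977), II §2 Prop. 2.5, I Ex. 2.12,
  II Ex. 5.11, II §4 (separatedness and graphs).
* [StacksProject] The Stacks Project, Tag 01KS.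
-/

noncomputable section

open CategoryTheory AlgebraicGeometry Limits Set Order MonoidalCategory CartesianMonoidalCategory
open _root_.Topology TopologicalSpace
open Literature.AlgebraicGeometry.Motives Literature.AlgebraicGeometry.Motives.ProjectiveSpace

namespace Literature.AlgebraicGeometry.HodgeTheory

attribute [local instance] MvPolynomial.gradedAlgebra

section HodgeTheory

variable {𝒳 S : Motives.SchemeOver ℂ}

/-! ### Parametrised families of supports -/

/-- A **parametrised family of supports** for `𝒳` over `S`: a parameter `ℂ`-scheme `T` with its
morphism `h : T ⟶ S` and a subset `𝒵 ⊆ 𝒳 × T` (the support over a complex point `y` of `T` is the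
slice `{x | (x, y) ∈ 𝒵}` of the fibre `𝒳_{h(y)}`). The shape of the parameter spaces of the
structure theorem on algebraicity loci (`algebraicityLocus_eq_iUnion_of_dichotomy`). [folklore] -/
structure SupportFamily (𝒳 S : Motives.SchemeOver ℂ) where
  /-- The parameter scheme. -/
  T : Motives.SchemeOver ℂ
  /-- Its morphism to the base. -/
  h : T ⟶ S
  /-- The family of supports, a subset of `𝒳 × T`. -/
  𝒵 : Set (𝒳 ⊗ T).left

namespace SupportFamily

/-- **The graph family**: parameter space `S` itself, support over `t` the whole fibre `𝒳_t`
(`𝒵 = Γ_f ⊆ 𝒳 × S`, the graph of `f`). [folklore] -/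
def graph (f : 𝒳 ⟶ S) : SupportFamily 𝒳 S where
  T := S
  h := 𝟙 S
  𝒵 := Set.range (CartesianMonoidalCategory.lift (𝟙 𝒳) f).left.base

/-- **One more condition**: from a family `W` with parameters `T` and a subset `Inc ⊆ 𝒳 × D`
(an incidence condition with parameters `D`), the family with parameters `D × T` whose support
over `(a, y)` is `Inc_a ∩ (W.𝒵)_y`. [folklore] -/
def step (D : Motives.SchemeOver ℂ) (Inc : Set (𝒳 ⊗ D).left) (W : SupportFamily 𝒳 S) :
    SupportFamily 𝒳 S where
  T := D ⊗ W.T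
  h := CartesianMonoidalCategory.snd D W.T ≫ W.h
  𝒵 := (𝒳 ◁ CartesianMonoidalCategory.fst D W.T).left.base ⁻¹' Inc ∩
    (𝒳 ◁ CartesianMonoidalCategory.snd D W.T).left.base ⁻¹' W.𝒵

variable (f : 𝒳 ⟶ S)

/-- The graph `(𝟙, f) : 𝒳 ⟶ 𝒳 × S` is a closed immersion when `S` is separated over `ℂ` (a section
of the separated projection `𝒳 × S → 𝒳`). [cite: StacksProject, Tag 01KS] -/
theorem isClosedImmersion_lift_id [IsSeparated S.hom] :
    IsClosedImmersion (CartesianMonoidalCategory.lift (𝟙 𝒳) f).left := by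
  have h : (CartesianMonoidalCategory.lift (𝟙 𝒳) f).left ≫
      (CartesianMonoidalCategory.fst 𝒳 S).left = 𝟙 _ := by
    rw [← Over.comp_left, CartesianMonoidalCategory.lift_fst]
    rfl
  haveI : IsSeparated (CartesianMonoidalCategory.fst 𝒳 S).left :=
    inferInstanceAs (IsSeparated (pullback.fst 𝒳.hom S.hom))
  haveI : IsClosedImmersion ((CartesianMonoidalCategory.lift (𝟙 𝒳) f).left ≫
      (CartesianMonoidalCategory.fst 𝒳 S).left) := by
    rw [h]
    infer_instance
  exact IsClosedImmersion.of_comp _ (CartesianMonoidalCategory.fst 𝒳 S).left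

/-- The graph family has a closed support set. [folklore] -/
theorem isClosed_graph_𝒵 [IsSeparated S.hom] : IsClosed (graph f).𝒵 := by
  haveI := isClosedImmersion_lift_id f
  exact (CartesianMonoidalCategory.lift (𝟙 𝒳) f).left.isClosedEmbedding.isClosed_range

/-- `step` preserves closedness of the support set, for a closed incidence condition. [folklore] -/
theorem isClosed_step_𝒵 {D : Motives.SchemeOver ℂ} {Inc : Set (𝒳 ⊗ D).left} (hInc : IsClosed Inc)
    {W : SupportFamily 𝒳 S} (hW : IsClosed W.𝒵) : IsClosed (step D Inc W).𝒵 :=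
  (hInc.preimage (𝒳 ◁ CartesianMonoidalCategory.fst D W.T).left.continuous).inter
    (hW.preimage (𝒳 ◁ CartesianMonoidalCategory.snd D W.T).left.continuous)

/-- `step` preserves properness of the parameter morphism, for a proper `D`. [folklore] -/
theorem isProper_step_h {D : Motives.SchemeOver ℂ} [IsProper D.hom] (Inc : Set (𝒳 ⊗ D).left)
    {W : SupportFamily 𝒳 S} (hW : IsProper W.h.left) : IsProper (step D Inc W).h.left := by
  haveI := hW
  haveI : IsProper (CartesianMonoidalCategory.snd D W.T).left :=
    inferInstanceAs (IsProper (pullback.snd D.hom W.T.hom))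
  exact inferInstanceAs (IsProper ((CartesianMonoidalCategory.snd D W.T).left ≫ W.h.left))

/-! ### Points of the families -/

/-- A complex point `Q` of `𝒳` paired with `t = f(Q)` lies in the graph. [folklore] -/
theorem pt_lift_mem_graph_𝒵 (Q : Motives.ComplexPoints 𝒳) :
    AlgPoints.pt (CartesianMonoidalCategory.lift Q (AlgPoints.map f Q) :
      Motives.ComplexPoints (𝒳 ⊗ S)) ∈ (graph f).𝒵 := by
  refine ⟨Q.pt, ?_⟩
  rw [← AlgPoints.pt_map]
  congr 1
  rw [AlgPoints.map_apply, comp_lift, Category.comp_id, AlgPoints.map_apply]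

/-- A scheme point `x` of `𝒳` whose slice `(x, t)` lies in the graph lies over `t`:
`f(x) = pt t`. [folklore] -/
theorem apply_eq_pt_of_sliceAt_mem_graph_𝒵 (t : Motives.ComplexPoints S) (x : 𝒳.left)
    (hx : (sliceAt 𝒳 t).left.base x ∈ (graph f).𝒵) : f.left.base x = t.pt := by
  obtain ⟨x', hx'⟩ := hx
  have h1 : (CartesianMonoidalCategory.fst 𝒳 S).left.base
      ((CartesianMonoidalCategory.lift (𝟙 𝒳) f).left.base x') = x' := by
    change ((CartesianMonoidalCategory.lift (𝟙 𝒳) f) ≫ CartesianMonoidalCategory.fst 𝒳 S).left.base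
      x' = x'
    rw [CartesianMonoidalCategory.lift_fst]
    rfl
  have h2 : (CartesianMonoidalCategory.fst 𝒳 S).left.base ((sliceAt 𝒳 t).left.base x) = x := by
    change (sliceAt 𝒳 t ≫ CartesianMonoidalCategory.fst 𝒳 S).left.base x = x
    rw [sliceAt_fst]
    rfl
  have h3 : (CartesianMonoidalCategory.snd 𝒳 S).left.base
      ((CartesianMonoidalCategory.lift (𝟙 𝒳) f).left.base x') = f.left.base x' := by
    change ((CartesianMonoidalCategory.lift (𝟙 𝒳) f) ≫ CartesianMonoidalCategory.snd 𝒳 S).left.base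
      x' = _
    rw [CartesianMonoidalCategory.lift_snd]
  have hxx' : x' = x := by rw [← h1, hx', h2]
  rw [← hxx', ← h3, hx', snd_sliceAt_base]

/-- Membership in the support set of `step`, on complex points: `(Q, (a, y)) ∈ 𝒵'` iff
`(Q, a) ∈ Inc` and `(Q, y) ∈ 𝒵`. [folklore] -/
theorem pt_lift_mem_step_𝒵_iff {D : Motives.SchemeOver ℂ} (Inc : Set (𝒳 ⊗ D).left)
    (W : SupportFamily 𝒳 S) (Q : Motives.ComplexPoints 𝒳) (a : Motives.ComplexPoints D)
    (y : Motives.ComplexPoints W.T) :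
    AlgPoints.pt (CartesianMonoidalCategory.lift Q (CartesianMonoidalCategory.lift a y) :
        Motives.ComplexPoints (𝒳 ⊗ (D ⊗ W.T))) ∈ (step D Inc W).𝒵 ↔
      AlgPoints.pt (CartesianMonoidalCategory.lift Q a : Motives.ComplexPoints (𝒳 ⊗ D)) ∈ Inc ∧
        AlgPoints.pt (CartesianMonoidalCategory.lift Q y : Motives.ComplexPoints (𝒳 ⊗ W.T)) ∈
          W.𝒵 := by
  have h1 : (𝒳 ◁ CartesianMonoidalCategory.fst D W.T).left.base
      (AlgPoints.pt (CartesianMonoidalCategory.lift Q (CartesianMonoidalCategory.lift a y) :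
        Motives.ComplexPoints (𝒳 ⊗ (D ⊗ W.T)))) =
      AlgPoints.pt (CartesianMonoidalCategory.lift Q a : Motives.ComplexPoints (𝒳 ⊗ D)) := by
    rw [← AlgPoints.pt_map, AlgPoints.map_apply, CartesianMonoidalCategory.lift_whiskerLeft,
      CartesianMonoidalCategory.lift_fst]
  have h2 : (𝒳 ◁ CartesianMonoidalCategory.snd D W.T).left.base
      (AlgPoints.pt (CartesianMonoidalCategory.lift Q (CartesianMonoidalCategory.lift a y) :
        Motives.ComplexPoints (𝒳 ⊗ (D ⊗ W.T)))) =
      AlgPoints.pt (CartesianMonoidalCategory.lift Q y : Motives.ComplexPoints (𝒳 ⊗ W.T)) := by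
    rw [← AlgPoints.pt_map, AlgPoints.map_apply, CartesianMonoidalCategory.lift_whiskerLeft,
      CartesianMonoidalCategory.lift_snd]
  change (_ ∈ _ ∧ _ ∈ _) ↔ _
  rw [Set.mem_preimage, Set.mem_preimage, h1, h2]

/-- A scheme point `x` of `𝒳` with `(x, (a, y)) ∈ 𝒵'` has `(x, y) ∈ 𝒵`. [folklore] -/
theorem sliceAt_mem_of_sliceAt_mem_step_𝒵 {D : Motives.SchemeOver ℂ} (Inc : Set (𝒳 ⊗ D).left)
    (W : SupportFamily 𝒳 S) (a : Motives.ComplexPoints D) (y : Motives.ComplexPoints W.T)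
    (x : 𝒳.left)
    (hx : (sliceAt 𝒳
      (CartesianMonoidalCategory.lift a y : Motives.ComplexPoints (D ⊗ W.T))).left.base x ∈
        (step D Inc W).𝒵) :
    (sliceAt 𝒳 y).left.base x ∈ W.𝒵 := by
  have h := hx.2
  rw [Set.mem_preimage, whiskerLeft_sliceAt_base_apply, AlgPoints.map_apply,
    CartesianMonoidalCategory.lift_snd] at h
  exact h

end SupportFamily

/-! ### The hyperplane witness families -/

/-- **The hyperplane witness families** of a family `f : 𝒳 ⟶ S` with a map `ε : 𝒳 ⟶ ℙᴺ`: for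
`d m : ℕ`, the parameter space `((ℙ^{N_d})^*)^m × S` and the family of supports
`{(x, a₁, …, a_m, s) | f(x) = s, ε(x) ∈ s_d⁻¹(H_{a₁}) ∩ ⋯ ∩ s_d⁻¹(H_{a_m})}` — tuples of hyperplane
sections of `𝒳` re-embedded by the Segre–diagonal map `s_d` (`Motives.ProjectiveSpace.segrePow`),
i.e. tuples of hypersurface sections of degree `d + 1`, cut with the fibres of `f`
(`SupportFamily.graph`, `SupportFamily.step` with the incidence locus of
`Motives/UniversalHyperplaneSection`). [folklore] -/
def hyperplaneFamily (f : 𝒳 ⟶ S) {N : ℕ} (ε : 𝒳 ⟶ projectiveSpace N ℂ) (d : ℕ) :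
    ℕ → SupportFamily 𝒳 S
  | 0 => SupportFamily.graph f
  | m + 1 => SupportFamily.step (dualProjectiveSpace (segrePowDim N d) ℂ)
      ((incidenceLocus (segrePowDim N d) (ε ≫ segrePow N ℂ d) :
        Closeds (𝒳 ⊗ dualProjectiveSpace (segrePowDim N d) ℂ).left) :
          Set (𝒳 ⊗ dualProjectiveSpace (segrePowDim N d) ℂ).left)
      (hyperplaneFamily f ε d m)

variable (f : 𝒳 ⟶ S) {N : ℕ} (ε : 𝒳 ⟶ projectiveSpace N ℂ)

/-- The support sets of the hyperplane witness families are closed (`S` separated over `ℂ`).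
[folklore] -/
theorem isClosed_hyperplaneFamily_𝒵 [IsSeparated S.hom] (d : ℕ) :
    ∀ m, IsClosed (hyperplaneFamily f ε d m).𝒵
  | 0 => SupportFamily.isClosed_graph_𝒵 f
  | m + 1 => SupportFamily.isClosed_step_𝒵 (Closeds.isClosed _)
      (isClosed_hyperplaneFamily_𝒵 d m)

/-- The parameter morphisms of the hyperplane witness families are proper (products of projective
spaces over `S`). [folklore] -/
theorem isProper_hyperplaneFamily_h (d : ℕ) : ∀ m, IsProper (hyperplaneFamily f ε d m).h.left
  | 0 => inferInstanceAs (IsProper (𝟙 S.left))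
  | m + 1 => by
    haveI : IsProper (dualProjectiveSpace (segrePowDim N d) ℂ).hom :=
      isProper_projectiveSpace _ _
    exact SupportFamily.isProper_step_h _ (isProper_hyperplaneFamily_h d m)

/-- A scheme point `x` of `𝒳` whose slice at a complex point `y` of the parameter space lies in the
support set lies over `h(y)`: `f(x) = pt (h y)`. [folklore] -/
theorem apply_eq_pt_of_sliceAt_mem_hyperplaneFamily_𝒵 (d : ℕ) :
    ∀ (m : ℕ) (y : Motives.ComplexPoints (hyperplaneFamily f ε d m).T) (x : 𝒳.left),
      (sliceAt 𝒳 y).left.base x ∈ (hyperplaneFamily f ε d m).𝒵 →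
        f.left.base x = (AlgPoints.map (hyperplaneFamily f ε d m).h y).pt
  | 0 => fun y x hx => by
    have h1 : AlgPoints.map (hyperplaneFamily f ε d 0).h y = y := AlgPoints.map_id_apply y
    rw [h1]
    exact SupportFamily.apply_eq_pt_of_sliceAt_mem_graph_𝒵 f y x hx
  | m + 1 => fun y x hx => by
    obtain ⟨⟨a, y'⟩, rfl⟩ := AlgPoints.prodEquiv.symm.surjective y
    rw [AlgPoints.prodEquiv_symm_apply] at hx ⊢
    have h := SupportFamily.sliceAt_mem_of_sliceAt_mem_step_𝒵 _ _ a y' x hx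
    rw [apply_eq_pt_of_sliceAt_mem_hyperplaneFamily_𝒵 d m y' x h]
    congr 1
    change AlgPoints.map (hyperplaneFamily f ε d m).h y' =
      AlgPoints.map (CartesianMonoidalCategory.snd _ _ ≫ (hyperplaneFamily f ε d m).h)
        (CartesianMonoidalCategory.lift a y')
    rw [AlgPoints.map_comp_apply, AlgPoints.map_apply (CartesianMonoidalCategory.snd _ _),
      CartesianMonoidalCategory.lift_snd]

/-! ### The complex point of the parameter space attached to a tuple of hyperplanes -/

/-- The complex point `(a₀, (a₁, (… , t)))` of the parameter space `((ℙ^{N_d})^*)^m × S` attached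
to a base point `t` and a tuple `a` of hyperplanes. [folklore] -/
def tuplePoint (t : Motives.ComplexPoints S) (d : ℕ) :
    (m : ℕ) → (Fin m → Motives.ComplexPoints (dualProjectiveSpace (segrePowDim N d) ℂ)) →
      Motives.ComplexPoints (hyperplaneFamily f ε d m).T
  | 0 => fun _ => t
  | m + 1 => fun a => (CartesianMonoidalCategory.lift (a 0) (tuplePoint t d m (Fin.tail a)) :
      Motives.ComplexPoints
        (dualProjectiveSpace (segrePowDim N d) ℂ ⊗ (hyperplaneFamily f ε d m).T))

/-- `tuplePoint t a` lies over `t`. [folklore] -/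
theorem map_h_tuplePoint (t : Motives.ComplexPoints S) (d : ℕ) :
    ∀ (m : ℕ) (a : Fin m → Motives.ComplexPoints (dualProjectiveSpace (segrePowDim N d) ℂ)),
      AlgPoints.map (hyperplaneFamily f ε d m).h (tuplePoint f ε t d m a) = t
  | 0 => fun _ => AlgPoints.map_id_apply _
  | m + 1 => fun a => by
    change AlgPoints.map (CartesianMonoidalCategory.snd _ _ ≫ (hyperplaneFamily f ε d m).h)
      (CartesianMonoidalCategory.lift (a 0) (tuplePoint f ε t d m (Fin.tail a))) = t
    rw [AlgPoints.map_comp_apply, AlgPoints.map_apply (CartesianMonoidalCategory.snd _ _),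
      CartesianMonoidalCategory.lift_snd]
    exact map_h_tuplePoint t d m _

/-- **Membership in the support over `tuplePoint t a`, on complex points**: `(Q, (a, t)) ∈ 𝒵` iff
`(Q, aᵢ)` lies in the incidence locus of `ε ≫ s_d` for every `i` and `(Q, t)` lies in the graph of
`f`. [folklore] -/
theorem pt_lift_tuplePoint_mem_iff (t : Motives.ComplexPoints S) (d : ℕ)
    (Q : Motives.ComplexPoints 𝒳) :
    ∀ (m : ℕ) (a : Fin m → Motives.ComplexPoints (dualProjectiveSpace (segrePowDim N d) ℂ)),
      AlgPoints.pt (CartesianMonoidalCategory.lift Q (tuplePoint f ε t d m a) :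
          Motives.ComplexPoints (𝒳 ⊗ (hyperplaneFamily f ε d m).T)) ∈ (hyperplaneFamily f ε d m).𝒵 ↔
        (∀ i, AlgPoints.pt (CartesianMonoidalCategory.lift Q (a i) :
            Motives.ComplexPoints (𝒳 ⊗ dualProjectiveSpace (segrePowDim N d) ℂ)) ∈
          ((incidenceLocus (segrePowDim N d) (ε ≫ segrePow N ℂ d) :
            Closeds (𝒳 ⊗ dualProjectiveSpace (segrePowDim N d) ℂ).left) :
              Set (𝒳 ⊗ dualProjectiveSpace (segrePowDim N d) ℂ).left)) ∧
        AlgPoints.pt (CartesianMonoidalCategory.lift Q t : Motives.ComplexPoints (𝒳 ⊗ S)) ∈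
          (SupportFamily.graph f).𝒵
  | 0 => fun a => by
    constructor
    · exact fun h => ⟨fun i => i.elim0, h⟩
    · exact fun h => h.2
  | m + 1 => fun a => by
    change AlgPoints.pt (CartesianMonoidalCategory.lift Q (CartesianMonoidalCategory.lift (a 0)
        (tuplePoint f ε t d m (Fin.tail a))) : Motives.ComplexPoints (𝒳 ⊗ (_ ⊗ _))) ∈
      (SupportFamily.step _ _ (hyperplaneFamily f ε d m)).𝒵 ↔ _
    rw [SupportFamily.pt_lift_mem_step_𝒵_iff, pt_lift_tuplePoint_mem_iff t d Q m (Fin.tail a),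
      Fin.forall_fin_succ]
    simp only [Fin.tail]
    tauto

/-! ### Completeness: every closed subset of a fibre is a slice of a hyperplane witness family -/

/-- Two closed subsets of a `ℂ`-scheme locally of finite type with the same complex points are
equal (closed points are dense in closed subsets of a Jacobson space, and are the complex points).
[folklore] -/
theorem eq_of_isClosed_of_forall_pt_mem_iff {X : Motives.SchemeOver ℂ} [LocallyOfFiniteType X.hom]
    {A B : Set X.left} (hA : IsClosed A) (hB : IsClosed B)
    (h : ∀ P : Motives.ComplexPoints X, P.pt ∈ A ↔ P.pt ∈ B) : A = B := by
  haveI : JacobsonSpace X.left := LocallyOfFiniteType.jacobsonSpace X.hom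
  have hAB : A ∩ closedPoints X.left = B ∩ closedPoints X.left := by
    ext x
    constructor
    · rintro ⟨hx, hxc⟩
      obtain ⟨P, rfl⟩ : x ∈ Set.range (AlgPoints.pt : Motives.ComplexPoints X → X.left) := by
        rw [Motives.ComplexPoints.range_pt]; exact hxc
      exact ⟨(h P).1 hx, hxc⟩
    · rintro ⟨hx, hxc⟩
      obtain ⟨P, rfl⟩ : x ∈ Set.range (AlgPoints.pt : Motives.ComplexPoints X → X.left) := by
        rw [Motives.ComplexPoints.range_pt]; exact hxc
      exact ⟨(h P).2 hx, hxc⟩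
  rw [← hA.closure_eq, ← hB.closure_eq,
    ← JacobsonSpace.closure_inter_closedPoints_eq_closure hA.isLocallyClosed,
    ← JacobsonSpace.closure_inter_closedPoints_eq_closure hB.isLocallyClosed, hAB]

/-- On complex points, the slice map is pairing with the parameter: `i_y(Q) = (Q, y)`. [folklore] -/
theorem map_sliceAt_eq_lift {T : Motives.SchemeOver ℂ} (y : Motives.ComplexPoints T)
    (Q : Motives.ComplexPoints 𝒳) :
    AlgPoints.map (sliceAt 𝒳 y) Q = CartesianMonoidalCategory.lift Q y := by
  rw [AlgPoints.map_apply, sliceAt, comp_lift, Category.comp_id, ← Category.assoc,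
    AlgPoints.endSpecOver_eq_id (Q ≫ toSpecOver 𝒳), Category.id_comp]

/-- **Completeness of the hyperplane witness families.** Let `f : 𝒳 ⟶ S` be a morphism of
`ℂ`-schemes locally of finite type with `S` separated and locally of finite type over `ℂ`, and
`ε : 𝒳 ⟶ ℙᴺ` a `ℂ`-morphism which is a topological embedding (e.g. an immersion). Then every
Zariski-closed subset `Z` of a fibre `𝒳_t` (`t ∈ S(ℂ)`) is the slice of some hyperplane witness
family: there are `d`, `m` and a complex point `y` of `((ℙ^{N_d})^*)^m × S` over `t` such that a
point `z` of `𝒳_t` lies in `Z` iff `(ι_t z, y) ∈ 𝒵_{d,m}`. Proof: `ι_t(Z)` is closed in `𝒳`, hence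
`= ε⁻¹(W)` for a closed `W ⊆ ℙᴺ` (embedding), `W = ⋂ V₊(gᵢ)` for forms `gᵢ ≠ 0` of one degree
`d + 1` (`Motives.exists_forms_eq_iInter_zeroLocus_of_isClosed`), the `gᵢ` are hyperplanes `aᵢ` of
`ℙ^{N_d}` through `s_d` (`Motives.ProjectiveSpace.segreCoeff`), and the slice over
`y = (a₁, …, a_m, t)` agrees with `Z` on complex points
(`pt_lift_segreCoeff_mem_incidenceLocus_iff_mem_zeroLocus'`), hence equals it (both are closed in
the Jacobson scheme `𝒳_t`). [cite: Hartshorne1977, II §2 Prop. 2.5 and I Ex. 2.12] -/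
theorem exists_tuplePoint_forall_mem_iff [IsSeparated S.hom] [LocallyOfFiniteType S.hom]
    [IsProper f.left] (hε : IsEmbedding ε.left.base) (t : Motives.ComplexPoints S)
    {Z : Set (Motives.fiberOver f t).left} (hZ : IsClosed Z) :
    ∃ (d m : ℕ) (y : Motives.ComplexPoints (hyperplaneFamily f ε d m).T),
      AlgPoints.map (hyperplaneFamily f ε d m).h y = t ∧
      ∀ z : (Motives.fiberOver f t).left, z ∈ Z ↔
        (sliceAt 𝒳 y).left.base ((Motives.fiberι f t).left.base z) ∈
          (hyperplaneFamily f ε d m).𝒵 := by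
  classical
  -- `ι_t(Z)` is closed in `𝒳` and is `ε⁻¹(W)` for a closed `W ⊆ ℙᴺ`
  haveI : IsClosedImmersion t.left := AlgPoints.isClosedImmersion_toSpecHom S t
  haveI : IsClosedImmersion (Motives.fiberι f t).left :=
    MorphismProperty.pullback_fst (P := @IsClosedImmersion) f.left t.left inferInstance
  have hιZ : IsClosed ((Motives.fiberι f t).left.base '' Z) :=
    (Motives.fiberι f t).left.isClosedEmbedding.isClosedMap _ hZ
  obtain ⟨W, hW, hWZ⟩ := hε.isInducing.isClosed_iff.1 hιZ
  -- `W = ⋂ V₊(g i)`, forms of degree `d + 1`; keep the non-zero ones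
  obtain ⟨d₀, m₀, g, hd₀, hg, hWg⟩ := exists_forms_eq_iInter_zeroLocus_of_isClosed hW
  obtain ⟨d, rfl⟩ : ∃ d, d₀ = d + 1 := Nat.exists_eq_succ_of_ne_zero hd₀.ne'
  obtain ⟨m, ⟨e⟩⟩ := Finite.exists_equiv_fin {i : Fin m₀ // g i ≠ 0}
  let g' : Fin m → MvPolynomial (Fin (N + 1)) ℂ := fun j => g (e.symm j).1
  have hg' : ∀ j, (g' j).IsHomogeneous (d + 1) := fun j => hg _
  have hg'0 : ∀ j, g' j ≠ 0 := fun j => (e.symm j).2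
  have hWg' : W = ⋂ j, ProjectiveSpectrum.zeroLocus
      (MvPolynomial.homogeneousSubmodule (Fin (N + 1)) ℂ) {g' j} := by
    rw [hWg]
    ext q
    simp only [Set.mem_iInter]
    constructor
    · exact fun h j => h _
    · intro h i
      by_cases hi : g i = 0
      · rw [hi, ProjectiveSpectrum.zeroLocus_singleton_zero]
        exact Set.mem_univ _
      · have h' := h (e ⟨i, hi⟩)
        simp only [g', Equiv.symm_apply_apply] at h'
        exact h'
  -- the hyperplanes and the parameter point
  let a : Fin m → Motives.ComplexPoints (dualProjectiveSpace (segrePowDim N d) ℂ) := fun j =>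
    pointOfVec ℂ (segreCoeff d (g' j)) (segreCoeff_ne_zero (hg' j) (hg'0 j))
  refine ⟨d, m, tuplePoint f ε t d m a, map_h_tuplePoint f ε t d m a, ?_⟩
  -- the slice and `Z` are closed subsets of `𝒳_t` with the same complex points
  haveI : IsProper (Motives.fiberOver f t).hom := isProper_fiberOver_hom f t
  set y := tuplePoint f ε t d m a with hy
  have hZ'c : IsClosed {z : (Motives.fiberOver f t).left |
      (sliceAt 𝒳 y).left.base ((Motives.fiberι f t).left.base z) ∈ (hyperplaneFamily f ε d m).𝒵} :=
    (isClosed_hyperplaneFamily_𝒵 f ε d m).preimage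
      ((sliceAt 𝒳 y).left.continuous.comp (Motives.fiberι f t).left.continuous)
  suffices hZZ' : Z = {z : (Motives.fiberOver f t).left |
      (sliceAt 𝒳 y).left.base ((Motives.fiberι f t).left.base z) ∈ (hyperplaneFamily f ε d m).𝒵} by
    intro z
    conv_lhs => rw [hZZ']
    rfl
  refine eq_of_isClosed_of_forall_pt_mem_iff hZ hZ'c fun P => ?_
  -- translate both memberships for the complex point `P` of `𝒳_t`, `Q = ι_t P`
  have hinj : Function.Injective (Motives.fiberι f t).left.base :=
    (Motives.fiberι f t).left.isClosedEmbedding.injective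
  have hPZ : P.pt ∈ Z ↔ ε.left.base ((Motives.fiberι f t).left.base P.pt) ∈ W := by
    have h : (Motives.fiberι f t).left.base P.pt ∈ ε.left.base ⁻¹' W ↔
        (Motives.fiberι f t).left.base P.pt ∈ (Motives.fiberι f t).left.base '' Z := by
      rw [hWZ]
    rw [Set.mem_preimage] at h
    rw [h]
    exact ⟨fun hP => Set.mem_image_of_mem _ hP, fun ⟨z, hz, hzP⟩ => hinj hzP ▸ hz⟩
  have hslice : (sliceAt 𝒳 y).left.base ((Motives.fiberι f t).left.base P.pt) =
      AlgPoints.pt (CartesianMonoidalCategory.lift (AlgPoints.map (Motives.fiberι f t) P) y :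
        Motives.ComplexPoints (𝒳 ⊗ (hyperplaneFamily f ε d m).T)) := by
    rw [← map_sliceAt_eq_lift, AlgPoints.pt_map, AlgPoints.pt_map]
  rw [Set.mem_setOf_eq, hPZ, hslice, hy, pt_lift_tuplePoint_mem_iff]
  -- the graph condition holds, the incidence conditions are `ε(Q) ∈ V₊(g' j)`
  have hgraph : AlgPoints.pt
      (CartesianMonoidalCategory.lift (AlgPoints.map (Motives.fiberι f t) P) t :
        Motives.ComplexPoints (𝒳 ⊗ S)) ∈ (SupportFamily.graph f).𝒵 := by
    have h := SupportFamily.pt_lift_mem_graph_𝒵 f (AlgPoints.map (Motives.fiberι f t) P)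
    rwa [AlgPoints.map_map_fiberι] at h
  have hinc : ∀ j, AlgPoints.pt (CartesianMonoidalCategory.lift
        (AlgPoints.map (Motives.fiberι f t) P) (a j) :
          Motives.ComplexPoints (𝒳 ⊗ dualProjectiveSpace (segrePowDim N d) ℂ)) ∈
      ((incidenceLocus (segrePowDim N d) (ε ≫ segrePow N ℂ d) :
        Closeds (𝒳 ⊗ dualProjectiveSpace (segrePowDim N d) ℂ).left) :
          Set (𝒳 ⊗ dualProjectiveSpace (segrePowDim N d) ℂ).left) ↔
      (AlgPoints.map ε (AlgPoints.map (Motives.fiberι f t) P)).pt ∈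
        ProjectiveSpectrum.zeroLocus (MvPolynomial.homogeneousSubmodule (Fin (N + 1)) ℂ) {g' j} :=
    fun j => pt_lift_segreCoeff_mem_incidenceLocus_iff_mem_zeroLocus' ε _ (hg' j) (hg'0 j)
  simp only [hinc, hgraph, and_true]
  rw [hWg']
  exact Set.mem_iInter

end HodgeTheory

end Literature.AlgebraicGeometry.HodgeTheory

end
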